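import Mathlib.Analysis.SpecialFunctions.Log.Deriv
import Mathlib.Analysis.Complex.ExponentialBounds
import Literature.Topology.FourManifolds.RadialStretch
import HarnessLib

/-!
# Bär–Hanke's logarithmic cut-off functions (Local flexibility, Lemma 10)

Topic `Literature/Geometry/Riemannian` (namespace `Literature.Geometry.Riemannian.BaerHanke`).
A brick of the printed proof of the named facts
`Literature.Geometry.Riemannian.BarHanke2023_thm27_umbilicNormalForm` (`BaerHankeNormalForm.lean`)
and `Literature.Geometry.Riemannian.BaerHankePscGluing` (`BaerHankeGluing.lean`): Bär–Hanke,
*Boundary conditions for scalar curvature*, §3, Prop. 23 (the `C`-normalisation of a metric of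
scalar curvature `> σ`) globalises the local deformation `F(s) = g - s((½g̈₀ + Cg₀)t² + R_t)` by
the **local flexibility lemma** of [BarHanke2021] (Thm. 1 / Addendum 19 there), whose analytic
input are the "efficient cut-off functions" of [BarHanke2021, Lemma 10] (proved in Appendix B
there): cut-offs decaying from `1` to `0` across the range `[δε, ε]` LOGARITHMICALLY slowly, so
that `r^k |τ^{(k)}(r)|` is small, uniformly in `ε`, once `|log δ|` is large.

**Lemma 10** ([BarHanke2021], p. 6). *For every `k ∈ ℕ` there is a constant `C_k > 0` and for
`0 < δ < 1/4` and `0 < ε < 1` there are `C^∞`-functions `τ_{δ,ε} : ℝ → ℝ` with*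
*(i) `τ_{δ,ε}(r) = 1` for `r ≤ δε`; (ii) `τ_{δ,ε}(r) = 0` for `r ≥ ε`; (iii) `0 ≤ τ_{δ,ε} ≤ 1`;*
*(iv) `|τ_{δ,ε}^{(k)}(r)| ≤ C_k · r^{-k} · |log δ|⁻¹` for all `r > 0` and all `k > 0`.*

This file PROVES the lemma for the derivatives of order `k ≤ 2` (`BaerHanke.exists_logCutoff`),
which is what a second-order relation such as `scal > σ` consumes; the hypothesis `ε < 1` of the
printed statement is not needed and is dropped.
-- TODO(general form): property (iv) for all orders `k` (same construction; induction on `k`).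

Construction. The printed proof (App. B) smooths the piecewise function
`τ̂(r) = log(r/ε) / log δ` on `[δε, ε]` (`= 1` below, `= 0` above) at its two corners. We use the
equivalent one-line variant `τ(r) = S((log ε - log r) / L)` for `r > 0`, `L = |log δ| = -log δ`,
`S` = Mathlib's `Real.smoothTransition` (`= 0` on `(-∞, 0]`, `= 1` on `[1, ∞)`, values in
`[0, 1]`), extended by `1` to `r ≤ 0`; the chain rule gives `τ'(r) = -S'(u)/(L r)` and
`τ''(r) = (S''(u)/L + S'(u))/(L r²)` with `u = (log ε - log r)/L`, whence (iv) with
`C = ‖S'‖_∞ + ‖S''‖_∞ + 1` because `L ≥ 1` for `δ < 1/4 ≤ e⁻¹` (a deviation in the choice of the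
smoothing only; the statement is the printed one).

Everything is proved; no definitions and no named facts are introduced (D-0026). The vanishing of
`S'` off `[0, 1]` is reused from `Literature/Topology/FourManifolds/RadialStretch.lean`
(`Literature.Topology.FourManifolds.deriv_smoothTransition_of_neg/of_one_lt`).

## References

* [BarHanke2021] C. Bär, B. Hanke, *Local flexibility for open partial differential relations*,
  Comm. Pure Appl. Math. 75 (2022) 1377–1415 = arXiv:1809.05703, §2, Lemma 10 (p. 6) and its
  proof, Appendix B (p. 21 of the arXiv version). READ.
* [BarHanke2023] C. Bär, B. Hanke, *Boundary conditions for scalar curvature*, in *Perspectives in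
  scalar curvature*, Vol. 2, World Sci. 2023, 325–377 = arXiv:2012.09127, §3, proof of Prop. 23
  (p. 11: "By the family version of the flexibility lemma … `F` can be replaced by a deformation
  `f` of `g` defined on all of `M`"). READ.
-/

noncomputable section

open Real Set Filter
open scoped Topology ContDiff

namespace Literature.Geometry.Riemannian

namespace BaerHanke

open Literature.Topology.FourManifolds (deriv_smoothTransition_of_neg
  deriv_smoothTransition_of_one_lt)

/-! ### Bounds for the derivatives of `Real.smoothTransition` -/

/-- A continuous real function vanishing off `[0, 1]` is bounded. [folklore] -/
theorem exists_forall_abs_le_of_eq_zero_off_unitInterval {f : ℝ → ℝ} (hf : Continuous f)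
    (h0 : ∀ x, x < 0 → f x = 0) (h1 : ∀ x, 1 < x → f x = 0) :
    ∃ M : ℝ, 0 ≤ M ∧ ∀ x, |f x| ≤ M := by
  obtain ⟨C, hC⟩ := (isCompact_Icc (a := (0 : ℝ)) (b := 1)).exists_bound_of_continuousOn
    hf.continuousOn
  refine ⟨max C 0, le_max_right _ _, fun x ↦ ?_⟩
  by_cases hx : x ∈ Icc (0 : ℝ) 1
  · have h := hC x hx
    rw [Real.norm_eq_abs] at h
    exact h.trans (le_max_left _ _)
  · rw [mem_Icc, not_and_or, not_le, not_le] at hx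
    rcases hx with hx | hx
    · rw [h0 x hx, abs_zero]
      exact le_max_right _ _
    · rw [h1 x hx, abs_zero]
      exact le_max_right _ _

/-- `S'' = 0` to the left of `0`. [folklore] -/
theorem deriv_deriv_smoothTransition_of_neg {x : ℝ} (hx : x < 0) :
    deriv (deriv smoothTransition) x = 0 := by
  have h : deriv smoothTransition =ᶠ[𝓝 x] fun _ ↦ (0 : ℝ) :=
    (eventually_lt_nhds hx).mono fun y hy ↦ deriv_smoothTransition_of_neg hy
  rw [h.deriv_eq, deriv_const]

/-- `S'' = 0` to the right of `1`. [folklore] -/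
theorem deriv_deriv_smoothTransition_of_one_lt {x : ℝ} (hx : 1 < x) :
    deriv (deriv smoothTransition) x = 0 := by
  have h : deriv smoothTransition =ᶠ[𝓝 x] fun _ ↦ (0 : ℝ) :=
    (eventually_gt_nhds hx).mono fun y hy ↦ deriv_smoothTransition_of_one_lt hy
  rw [h.deriv_eq, deriv_const]

/-- The first derivative of `Real.smoothTransition` is globally bounded (it is continuous and
vanishes off `[0, 1]`). [folklore] -/
theorem exists_bound_deriv_smoothTransition :
    ∃ M : ℝ, 0 ≤ M ∧ ∀ x, |deriv smoothTransition x| ≤ M :=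
  exists_forall_abs_le_of_eq_zero_off_unitInterval
    ((smoothTransition.contDiff (n := ⊤)).continuous_deriv (by simp))
    (fun _ hx ↦ deriv_smoothTransition_of_neg hx) fun _ hx ↦ deriv_smoothTransition_of_one_lt hx

/-- The second derivative of `Real.smoothTransition` is globally bounded. [folklore] -/
theorem exists_bound_deriv_deriv_smoothTransition :
    ∃ M : ℝ, 0 ≤ M ∧ ∀ x, |deriv (deriv smoothTransition) x| ≤ M :=
  exists_forall_abs_le_of_eq_zero_off_unitInterval
    ((contDiff_infty_iff_deriv.mp (smoothTransition.contDiff (n := ⊤))).2.continuous_deriv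
      (by simp))
    (fun _ hx ↦ deriv_deriv_smoothTransition_of_neg hx)
    fun _ hx ↦ deriv_deriv_smoothTransition_of_one_lt hx

/-! ### The logarithmic cut-off -/

/-- `δ < 1/4` forces `-log δ ≥ 1` (since `1/4 ≤ e⁻¹`). [folklore] -/
theorem one_le_neg_log_of_lt_quarter {δ : ℝ} (hδ : 0 < δ) (hδ4 : δ < 1 / 4) :
    1 ≤ -Real.log δ := by
  have he : Real.exp 1 < 4 := lt_trans Real.exp_one_lt_three (by norm_num)
  have hinv : 4 < δ⁻¹ := by
    rw [lt_inv_comm₀ (by norm_num) hδ]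
    simpa [one_div] using hδ4
  have h4 : δ ≤ Real.exp (-1) := by
    rw [Real.exp_neg, le_inv_comm₀ hδ (Real.exp_pos 1)]
    linarith
  have h := Real.log_le_log hδ h4
  rw [Real.log_exp] at h
  linarith

/-- **Bär–Hanke, Local flexibility, Lemma 10** (efficient logarithmic cut-off functions; orders
`k ≤ 2`): there is a constant `C > 0` such that for all `0 < δ < 1/4` and `ε > 0` there is a smooth
`τ = τ_{δ,ε} : ℝ → ℝ` with `τ(r) = 1` for `r ≤ δε`, `τ(r) = 0` for `r ≥ ε`, `0 ≤ τ ≤ 1`, and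
`|τ'(r)| ≤ C/(r |log δ|)`, `|τ''(r)| ≤ C/(r² |log δ|)` for all `r > 0`.
[cite: BarHanke2021, §2 Lemma 10 and Appendix B] -/
theorem exists_logCutoff : ∃ C : ℝ, 0 < C ∧ ∀ δ ε : ℝ, 0 < δ → δ < 1 / 4 → 0 < ε →
    ∃ τ : ℝ → ℝ, ContDiff ℝ ∞ τ ∧
      (∀ r, r ≤ δ * ε → τ r = 1) ∧
      (∀ r, ε ≤ r → τ r = 0) ∧
      (∀ r, 0 ≤ τ r ∧ τ r ≤ 1) ∧
      (∀ r, 0 < r → |deriv τ r| ≤ C / (r * |Real.log δ|)) ∧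
      (∀ r, 0 < r → |deriv (deriv τ) r| ≤ C / (r ^ 2 * |Real.log δ|)) := by
  obtain ⟨M₁, hM₁0, hM₁⟩ := exists_bound_deriv_smoothTransition
  obtain ⟨M₂, hM₂0, hM₂⟩ := exists_bound_deriv_deriv_smoothTransition
  refine ⟨M₁ + M₂ + 1, by positivity, fun δ ε hδ hδ4 hε ↦ ?_⟩
  -- the logarithmic scale `L = |log δ| ≥ 1`
  set L : ℝ := -Real.log δ with hL
  have hlogδ : Real.log δ < 0 := Real.log_neg hδ (by linarith)
  have hL1 : 1 ≤ L := one_le_neg_log_of_lt_quarter hδ hδ4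
  have hLpos : 0 < L := by linarith
  have habsL : |Real.log δ| = L := abs_of_neg hlogδ
  have hδε : 0 < δ * ε := mul_pos hδ hε
  -- differentiability of `S = smoothTransition` and of `S'`
  have hSd : Differentiable ℝ smoothTransition :=
    (smoothTransition.contDiff (n := ⊤)).differentiable (by simp)
  have hS'd : Differentiable ℝ (deriv smoothTransition) :=
    (contDiff_infty_iff_deriv.mp (smoothTransition.contDiff (n := ⊤))).2.differentiable (by simp)
  -- the cut-off: `S((log ε - log r)/L)` on `r > 0`, `1` on `r ≤ 0`
  set a : ℝ := Real.log ε with ha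
  set u : ℝ → ℝ := fun r ↦ (a - Real.log r) / L with hu
  set F : ℝ → ℝ := fun r ↦ smoothTransition (u r) with hF
  set τ : ℝ → ℝ := fun r ↦ if r ≤ δ * ε / 2 then 1 else F r with hτ
  -- `F = 1` on `(0, δε]`, `F = 0` on `[ε, ∞)`
  have hF1 : ∀ r, 0 < r → r ≤ δ * ε → F r = 1 := by
    intro r hr hrle
    apply smoothTransition.one_of_one_le
    show 1 ≤ (a - Real.log r) / L
    rw [le_div_iff₀ hLpos, one_mul]
    have h := Real.log_le_log hr hrle
    rw [Real.log_mul hδ.ne' hε.ne'] at h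
    rw [hL, ha]
    linarith
  have hF0 : ∀ r, ε ≤ r → F r = 0 := by
    intro r hr
    apply smoothTransition.zero_of_nonpos
    show (a - Real.log r) / L ≤ 0
    rw [div_le_iff₀ hLpos, zero_mul]
    have h := Real.log_le_log hε hr
    rw [ha]
    linarith
  -- `τ = F` on `(0, ∞)` and `τ = 1` on `(-∞, δε]`
  have hτF : ∀ r, 0 < r → τ r = F r := by
    intro r hr
    by_cases h : r ≤ δ * ε / 2
    · rw [show τ r = 1 from if_pos h, hF1 r hr (by linarith)]
    · exact if_neg h
  have hτ1 : ∀ r, r ≤ δ * ε → τ r = 1 := by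
    intro r hr
    by_cases h : r ≤ δ * ε / 2
    · exact if_pos h
    · rw [show τ r = F r from if_neg h]
      push Not at h
      exact hF1 r (by linarith) hr
  have hτF_ev : ∀ r, 0 < r → τ =ᶠ[𝓝 r] F := fun r hr ↦
    (eventually_gt_nhds hr).mono fun y hy ↦ hτF y hy
  have hτ1_ev : ∀ r, r < δ * ε → τ =ᶠ[𝓝 r] fun _ ↦ (1 : ℝ) := fun r hr ↦
    (eventually_lt_nhds hr).mono fun y hy ↦ hτ1 y hy.le
  -- calculus of `u` and `F` on `(0, ∞)`
  have hu' : ∀ r, 0 < r → HasDerivAt u (-(1 / (L * r))) r := by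
    intro r hr
    rw [hu]
    exact (((Real.hasDerivAt_log hr.ne').const_sub a).div_const L).congr_deriv (by ring)
  have hF' : ∀ r, 0 < r →
      HasDerivAt F (deriv smoothTransition (u r) * (-(1 / (L * r)))) r := fun r hr ↦
    (hSd (u r)).hasDerivAt.comp r (hu' r hr)
  have hFsmooth : ∀ r, 0 < r → ContDiffAt ℝ ∞ F r := by
    intro r hr
    have hlog : ContDiffAt ℝ ∞ Real.log r := Real.contDiffAt_log.mpr hr.ne'
    have hu'' : ContDiffAt ℝ ∞ u r := (contDiffAt_const.sub hlog).div_const L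
    exact (smoothTransition.contDiffAt (n := ⊤)).comp r hu''
  -- smoothness of `τ`
  have hτsmooth : ContDiff ℝ ∞ τ := by
    rw [contDiff_iff_contDiffAt]
    intro r
    by_cases hr : 0 < r
    · exact (hFsmooth r hr).congr_of_eventuallyEq (hτF_ev r hr)
    · have h : r < δ * ε := by
        push Not at hr
        linarith
      exact contDiffAt_const.congr_of_eventuallyEq (hτ1_ev r h)
  -- first derivative on `(0, ∞)`
  have hderiv : ∀ r, 0 < r → deriv τ r = deriv smoothTransition (u r) * (-(1 / (L * r))) :=
    fun r hr ↦ by rw [(hτF_ev r hr).deriv_eq, (hF' r hr).deriv]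
  -- `deriv τ` agrees near `r > 0` with the explicit function `G`
  set G : ℝ → ℝ := fun y ↦ deriv smoothTransition (u y) * (-(1 / (L * y))) with hG
  have hderiv_ev : ∀ r, 0 < r → deriv τ =ᶠ[𝓝 r] G := fun r hr ↦
    (eventually_gt_nhds hr).mono fun y hy ↦ hderiv y hy
  have hG' : ∀ r, 0 < r → HasDerivAt G
      ((deriv (deriv smoothTransition) (u r) / L + deriv smoothTransition (u r)) /
        (L * r ^ 2)) r := by
    intro r hr
    have hLr : L * r ≠ 0 := mul_ne_zero hLpos.ne' hr.ne'
    have h1 : HasDerivAt (fun y ↦ deriv smoothTransition (u y))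
        (deriv (deriv smoothTransition) (u r) * (-(1 / (L * r)))) r :=
      (hS'd (u r)).hasDerivAt.comp r (hu' r hr)
    have h2 : HasDerivAt (fun y : ℝ ↦ -(1 / (L * y))) (1 / (L * r ^ 2)) r := by
      have hfun : (fun y : ℝ ↦ -(1 / (L * y))) = fun y ↦ -(1 / L) * y⁻¹ := by
        funext y
        ring
      rw [hfun]
      exact ((hasDerivAt_inv hr.ne').const_mul (-(1 / L))).congr_deriv (by field_simp)
    exact (h1.fun_mul h2).congr_deriv (by field_simp)
  have hderiv2 : ∀ r, 0 < r → deriv (deriv τ) r =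
      (deriv (deriv smoothTransition) (u r) / L + deriv smoothTransition (u r)) /
        (L * r ^ 2) :=
    fun r hr ↦ by rw [(hderiv_ev r hr).deriv_eq, (hG' r hr).deriv]
  refine ⟨τ, hτsmooth, hτ1, fun r hr ↦ ?_, fun r ↦ ?_, fun r hr ↦ ?_, fun r hr ↦ ?_⟩
  · -- `τ = 0` on `[ε, ∞)`
    rw [hτF r (hε.trans_le hr)]
    exact hF0 r hr
  · -- `0 ≤ τ ≤ 1`
    by_cases hr : 0 < r
    · rw [hτF r hr]
      exact ⟨smoothTransition.nonneg _, smoothTransition.le_one _⟩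
    · push Not at hr
      rw [hτ1 r (hr.trans hδε.le)]
      exact ⟨zero_le_one, le_rfl⟩
  · -- `|τ'(r)| ≤ C / (r |log δ|)`
    rw [hderiv r hr, habsL, abs_mul, abs_neg, abs_of_pos (by positivity : 0 < 1 / (L * r))]
    have hLr : 0 < L * r := by positivity
    calc |deriv smoothTransition (u r)| * (1 / (L * r))
        ≤ M₁ * (1 / (L * r)) := mul_le_mul_of_nonneg_right (hM₁ _) (by positivity)
      _ = M₁ / (r * L) := by rw [mul_comm r L]; ring
      _ ≤ (M₁ + M₂ + 1) / (r * L) :=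
          div_le_div_of_nonneg_right (by linarith) (by positivity)
  · -- `|τ''(r)| ≤ C / (r² |log δ|)`
    rw [hderiv2 r hr, habsL, abs_div, abs_of_pos (by positivity : 0 < L * r ^ 2)]
    have hnum : |deriv (deriv smoothTransition) (u r) / L + deriv smoothTransition (u r)| ≤
        M₁ + M₂ + 1 := by
      calc |deriv (deriv smoothTransition) (u r) / L + deriv smoothTransition (u r)|
          ≤ |deriv (deriv smoothTransition) (u r) / L| + |deriv smoothTransition (u r)| :=
            abs_add_le _ _
        _ ≤ M₂ + M₁ := by
            refine add_le_add ?_ (hM₁ _)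
            rw [abs_div, abs_of_pos hLpos, div_le_iff₀ hLpos]
            calc |deriv (deriv smoothTransition) (u r)| ≤ M₂ := hM₂ _
              _ = M₂ * 1 := (mul_one _).symm
              _ ≤ M₂ * L := mul_le_mul_of_nonneg_left hL1 hM₂0
        _ ≤ M₁ + M₂ + 1 := by linarith
    calc |deriv (deriv smoothTransition) (u r) / L + deriv smoothTransition (u r)| / (L * r ^ 2)
        ≤ (M₁ + M₂ + 1) / (L * r ^ 2) :=
          div_le_div_of_nonneg_right hnum (by positivity)
      _ = (M₁ + M₂ + 1) / (r ^ 2 * L) := by rw [mul_comm]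

end BaerHanke

end Literature.Geometry.Riemannian

end
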